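import Literature.Analysis.FluidPDE.Seregin2020CubicLowerBound
import Literature.Analysis.FluidPDE.LocalPlainPressureBound
import Literature.Analysis.FluidPDE.SlabPressureNormalization
import HarnessLib

/-!
# Seregin 2019, Proposition 4.1 (one-scale regularity with `C` small and the pressure merely
# bounded): velocity bound — direct form, contrapositive form (4.4), and the `D₀`-form in
# Albritton–Barker's class on a parabolic ball

Analysis/FluidPDE proofs-only file (theorems only: no definition, no named fact, no `sorry`).

G. Seregin, arXiv:1906.06707 = St. Petersburg Math. J. 32 (2021) 565–576 [`Seregin2019`], §4,
**Proposition 4.1** (quoting [`Seregin2016`]): "Let `v` and `q` be a suitable weak solution to the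
Navier–Stokes equations in `Q(z₀,R)`. Given `Z > 0`, there exist positive numbers `ε⋆(Z)` and
`c⋆(Z)` such that if `R⁻² ∫_{Q(z₀,R)} |v|³ < ε⋆(Z)` and `D₀(q,R;z₀) < Z` hold, then `v` and `∇v`
are Hölder continuous in the closure of `Q(z₀,R/2)`. Moreover `sup_{Q(z₀,R/2)} |v| + |∇v| ≤
c⋆(Z)/R`." The proof of Prop. 1.3 consumes it ONLY contrapositively and only through the velocity
bound (display (4.4): if `v ∉ L_∞(Q(εr))` then `ϱ⁻² ∫_{Q(ϱ)} |v|³ > ε⋆/2` for `ϱ ∈ [2εr, r]`).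

The mechanism — the decay estimate `D(θr) ≤ c(θ D(r) + θ⁻² C(r))` (Seregin–Šverák 2009, (as13);
`seregin_sverak_pressure_decay_holds`) followed by the one-scale ε-regularity criterion at the scale
`θ r`, at cylinders touching the top of the domain (`Seregin2020.exists_epsilonRegularity_top`) —
is in the tree as a LOWER BOUND for `C` at a backward SINGULAR point
(`Seregin2020.exists_le_cknC_of_isBackwardSingularPoint`, Seregin 2020 (2.9)). Recorded here in
the shapes Prop. 1.3 consumes: `ae_bound_of_cknC_le` (direct form, plain `D = cknD` bounded below
`r₀`, `C(r) ≤ κ` ⇒ `|u| ≤ C⋆/r` a.e. on `Q_{θr}(z)`), `le_cknC_of_not_bounded` (contrapositive =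
(4.4)), the ball-mean gauge `isSuitableWeakSolutionInBall_sub_ballMean` on `Q(z₀,R)` (turning
`D₀(R)` into `D(R)`, `cknD_sub_ballMean`), and the `D₀`-forms `le_cknC_of_not_bounded_inBall` /
`ae_bound_of_cknC_le_inBall` in the class `IsSuitableWeakSolutionInBall R z₀ u p` of Def. 1.1,
under `C ≤ M₁` on all sub-balls (print: (4.5) `Θ ≤ c(M)(N+1)`) and `D₀(R; z₀) ≤ L` at the ONE scale
`R` (plain `D` at sub-scales by the iterated decay estimate `exists_cknD_le_of_cknC_le`).

Differences from print (immaterial for Prop. 1.3): conclusion at the inner scale `θ(Z)·r` instead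
of `r/2` (so (4.4) reads `ϱ ∈ [εr/θ, r]`), velocity bound only.
-- TODO(general form): Hölder continuity of `v, ∇v` on the closure of `Q(z₀,R/2)` and
-- `|∇v| ≤ c⋆(Z)/R` (Seregin 2016); not used by the tree's consumers.

References: G. Seregin, arXiv:1906.06707 §4, Prop. 4.1, (4.4)–(4.5) [`Seregin2019`]; G. Seregin,
Zap. Nauchn. Sem. POMI 444 (2016) 124–132 [`Seregin2016`]; G. Seregin, V. Šverák, Comm. PDE 34
(2009), (as13) [`SereginSverak2009`]; G. Seregin, Anal. Math. Phys. 10 (2020), (2.9) [`Seregin2020`].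
-/

noncomputable section

open MeasureTheory Set Function Filter Topology TopologicalSpace Metric
open scoped NNReal ENNReal

namespace Literature.Analysis.FluidPDE

namespace Seregin2019

/-! ### Direct form: `C(r) ≤ κ`, `D ≤ L` below `r₀` ⇒ `|u| ≤ C⋆/r` a.e. on `Q_{θr}(z)` -/

/-- **Seregin 2019, Prop. 4.1 (velocity bound, direct form, plain pressure quantity).** For every
`L ≥ 0` there are `κ = κ(L) > 0`, `θ = θ(L) ∈ (0, 1]` and `C⋆ = C⋆(L) > 0` such that: if `(u, p)`
is a suitable weak solution of the unforced unit-viscosity Navier–Stokes equations on an open `Q`,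
`G` a weak spatial gradient of `u` on `Q`, `Q_{r₀}(z) ⊆ Q` (open inclusion) with
`A(r₀; z), E(r₀; z) < ∞` and `D(r; z) ≤ L` for all `0 < r ≤ r₀` (`D = cknD`), then for every
`0 < r ≤ r₀` with `C(r; z) ≤ κ` one has `|u| ≤ C⋆ / r` a.e. on `Q_{θ r}(z)`. Proof: the decay
estimate for the pressure at ratio `θ` (`seregin_sverak_pressure_decay_holds`) makes `C + D` small
at the scale `θ r`, and the one-scale ε-regularity criterion at cylinders touching the top
(`Seregin2020.exists_epsilonRegularity_top`) bounds `u` on `Q_{θr/2}(z)`; verbatim the argument of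
the tree's `Seregin2020.exists_le_cknC_of_isBackwardSingularPoint`, read directly.
[cite: Seregin2019, Prop. 4.1 (arXiv:1906.06707 §4)] -/
theorem ae_bound_of_cknC_le (L : ℝ≥0) :
    ∃ κ θ Cst : ℝ, 0 < κ ∧ 0 < θ ∧ θ ≤ 1 ∧ 0 < Cst ∧
      ∀ (Q : Opens (ℝ × EuclideanSpace ℝ (Fin 3)))
        (u : ℝ → EuclideanSpace ℝ (Fin 3) → EuclideanSpace ℝ (Fin 3))
        (p : ℝ → EuclideanSpace ℝ (Fin 3) → ℝ)
        (G : ℝ → EuclideanSpace ℝ (Fin 3) → EuclideanSpace ℝ (Fin 3) →L[ℝ] EuclideanSpace ℝ (Fin 3)),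
        IsSuitableWeakSolutionOn Q 1 0 u p → HasWeakSpatialGradientOn Q u G →
        ∀ (z : ℝ × EuclideanSpace ℝ (Fin 3)) (r₀ : ℝ), 0 < r₀ →
          parabolicCylinder r₀ z ⊆ (Q : Set (ℝ × EuclideanSpace ℝ (Fin 3))) →
          cknAEss r₀ z u ≠ ∞ → cknE r₀ z G ≠ ∞ →
          (∀ r ∈ Ioc (0 : ℝ) r₀, cknD r z p ≤ L) →
          ∀ r ∈ Ioc (0 : ℝ) r₀, cknC r z u ≤ ENNReal.ofReal κ →
            ∀ᵐ w ∂(volume.restrict (parabolicCylinder (θ * r) z)), ‖u w.1 w.2‖ ≤ Cst / r := by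
  obtain ⟨ε₀, C₀, hε₀, hC₀, Hreg⟩ := Seregin2020.exists_epsilonRegularity_top
  obtain ⟨c, Hdec⟩ := seregin_sverak_pressure_decay_holds.ratio
  set η : ℝ := ε₀ ^ 3 with hη
  have hηpos : 0 < η := pow_pos hε₀ 3
  set θ : ℝ := min (1 / 2) (η / (4 * ((c : ℝ) + 1) * ((L : ℝ) + 1))) with hθ
  have hθpos : 0 < θ := lt_min (by norm_num) (by positivity)
  have hθ1 : θ ≤ 1 := (min_le_left _ _).trans (by norm_num)
  set κ : ℝ := η * θ ^ 2 / (4 * ((c : ℝ) + 1)) with hκ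
  have hκpos : 0 < κ := by positivity
  refine ⟨κ, θ / 2, C₀ * ε₀ / θ, hκpos, by positivity, by linarith, by positivity,
    fun Q u p G hsw hG z r₀ hr₀ hQ hA₀ hE₀ hD r hr hCle => ?_⟩
  have hr0 : 0 < r := hr.1
  have hrr₀ : r ≤ r₀ := hr.2
  have hθr : 0 < θ * r := mul_pos hθpos hr0
  have hsubr : parabolicCylinder r z ⊆ (Q : Set (ℝ × EuclideanSpace ℝ (Fin 3))) :=
    (parabolicCylinder_mono hr0.le hrr₀ z).trans hQ
  -- ### the pressure at the scale `θ r`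
  have hDθ : cknD (θ * r) z p ≤
      (c : ℝ≥0∞) * (ENNReal.ofReal θ * L + ENNReal.ofReal (θ⁻¹ ^ 2) * ENNReal.ofReal κ) := by
    refine (Hdec Q u p hsw.distributional z r θ hr0 hθpos hθ1 hsubr).trans ?_
    have h1 : cknD r z p ≤ L := hD r hr
    gcongr
  -- ### the cubic quantity at the scale `θ r`
  have hCθ : cknC (θ * r) z u ≤ ENNReal.ofReal (θ⁻¹ ^ 2) * ENNReal.ofReal κ := by
    have hsub : parabolicCylinder (θ * r) z ⊆ parabolicCylinder r z :=
      parabolicCylinder_mono hθr.le (mul_le_of_le_one_left hr0.le hθ1) z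
    refine (Seregin2020.cknC_le_mul_of_subset hr0 hθr hsub u).trans ?_
    have e : ENNReal.ofReal (r / (θ * r)) ^ 2 = ENNReal.ofReal (θ⁻¹ ^ 2) := by
      rw [← ENNReal.ofReal_pow (by positivity)]
      congr 1
      field_simp
    rw [e]
    gcongr
  -- ### smallness of `C + D` at the scale `θ r`
  have hsmall : cknC (θ * r) z u + cknD (θ * r) z p ≤ ENNReal.ofReal (ε₀ ^ 3) := by
    have key := Seregin2020.const_ineq hηpos c.2 L.2 hθpos (min_le_right _ _) hκ.le
    calc cknC (θ * r) z u + cknD (θ * r) z p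
        ≤ ENNReal.ofReal (θ⁻¹ ^ 2) * ENNReal.ofReal κ +
            (c : ℝ≥0∞) * (ENNReal.ofReal θ * L + ENNReal.ofReal (θ⁻¹ ^ 2) * ENNReal.ofReal κ) :=
          add_le_add hCθ hDθ
      _ = ENNReal.ofReal ((c : ℝ) * θ * L + ((c : ℝ) + 1) * θ⁻¹ ^ 2 * κ) := by
          have hc0 : (0 : ℝ) ≤ c := c.2
          have hL0 : (0 : ℝ) ≤ L := L.2
          have hθi : (0 : ℝ) ≤ θ⁻¹ ^ 2 := by positivity
          rw [← ENNReal.ofReal_coe_nnreal (p := c), ← ENNReal.ofReal_coe_nnreal (p := L),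
            ← ENNReal.ofReal_mul hθpos.le, ← ENNReal.ofReal_mul hθi, ← ENNReal.ofReal_add
              (by positivity) (by positivity), ← ENNReal.ofReal_mul hc0, ← ENNReal.ofReal_add
              (by positivity) (by positivity)]
          congr 1
          ring
      _ ≤ ENNReal.ofReal (ε₀ ^ 3) := ENNReal.ofReal_le_ofReal key
  -- ### the ε-regularity criterion at the scale `θ r`
  have hD₀ : cknD r₀ z p ≠ ∞ := ne_top_of_le_ne_top ENNReal.coe_ne_top (hD r₀ ⟨hr₀, le_rfl⟩)
  have hbound := Hreg Q u p G hsw hG z r₀ hr₀ hQ hA₀ hE₀ hD₀ (θ * r) ε₀ hθr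
    ((mul_le_of_le_one_left hr0.le hθ1).trans hrr₀) hε₀.le le_rfl hsmall
  have e1 : θ / 2 * r = θ * r / 2 := by ring
  have e2 : C₀ * ε₀ / θ / r = C₀ * ε₀ / (θ * r) := by rw [div_div]
  rw [e1, e2]
  exact hbound

/-! ### Contrapositive form: unboundedness on `Q_ρ(z)` ⇒ `κ ≤ C(r)` for `r ∈ [ρ/θ, r₀]` -/

/-- **Seregin 2019, Prop. 4.1 in the contrapositive form of §4, display (4.4)** (plain pressure
quantity). For every `L ≥ 0` there are `κ = κ(L) > 0` and `θ = θ(L) ∈ (0, 1]` such that: if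
`(u, p)` is a suitable weak solution of the unforced unit-viscosity Navier–Stokes equations on an
open `Q`, `G` a weak spatial gradient of `u` on `Q`, `Q_{r₀}(z) ⊆ Q` with `A(r₀; z), E(r₀; z) < ∞`
and `D(r; z) ≤ L` for all `0 < r ≤ r₀`, and `u` is NOT essentially bounded on `Q_ρ(z)` for some
`ρ > 0`, then `κ ≤ C(r; z)` for every `r ∈ [ρ/θ, r₀]` (print: "`ϱ⁻² ∫_{Q(ϱ)} |vᵏ|³ > ε⋆/2` for
all `ϱ ∈ [2εₖrₖ, rₖ]`", with `θ(L)` in place of `1/2`).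
[cite: Seregin2019, Prop. 4.1 and (4.4) (arXiv:1906.06707 §4)] -/
theorem le_cknC_of_not_bounded (L : ℝ≥0) :
    ∃ κ θ : ℝ, 0 < κ ∧ 0 < θ ∧ θ ≤ 1 ∧
      ∀ (Q : Opens (ℝ × EuclideanSpace ℝ (Fin 3)))
        (u : ℝ → EuclideanSpace ℝ (Fin 3) → EuclideanSpace ℝ (Fin 3))
        (p : ℝ → EuclideanSpace ℝ (Fin 3) → ℝ)
        (G : ℝ → EuclideanSpace ℝ (Fin 3) → EuclideanSpace ℝ (Fin 3) →L[ℝ] EuclideanSpace ℝ (Fin 3)),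
        IsSuitableWeakSolutionOn Q 1 0 u p → HasWeakSpatialGradientOn Q u G →
        ∀ (z : ℝ × EuclideanSpace ℝ (Fin 3)) (r₀ : ℝ), 0 < r₀ →
          parabolicCylinder r₀ z ⊆ (Q : Set (ℝ × EuclideanSpace ℝ (Fin 3))) →
          cknAEss r₀ z u ≠ ∞ → cknE r₀ z G ≠ ∞ →
          (∀ r ∈ Ioc (0 : ℝ) r₀, cknD r z p ≤ L) →
          ∀ ρ : ℝ, 0 < ρ →
            ¬ (eLpNorm (uncurry u) ∞ (volume.restrict (parabolicCylinder ρ z)) < ∞) →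
            ∀ r ∈ Icc (ρ / θ) r₀, ENNReal.ofReal κ ≤ cknC r z u := by
  obtain ⟨κ, θ, Cst, hκ, hθ, hθ1, hCst, H⟩ := ae_bound_of_cknC_le L
  refine ⟨κ, θ, hκ, hθ, hθ1, fun Q u p G hsw hG z r₀ hr₀ hQ hA₀ hE₀ hD ρ hρ hunb r hr => ?_⟩
  have hρθ : ρ ≤ θ * r := by
    have h := hr.1
    rw [div_le_iff₀ hθ] at h
    linarith
  have hr0 : 0 < r := lt_of_lt_of_le (div_pos hρ hθ) hr.1
  by_contra hlt
  rw [not_le] at hlt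
  have hbound := H Q u p G hsw hG z r₀ hr₀ hQ hA₀ hE₀ hD r ⟨hr0, hr.2⟩ hlt.le
  have hfin : eLpNorm (uncurry u) ∞ (volume.restrict (parabolicCylinder (θ * r) z)) < ∞ := by
    rw [eLpNorm_exponent_top]
    exact eLpNormEssSup_lt_top_of_ae_bound hbound
  refine hunb (lt_of_le_of_lt ?_ hfin)
  exact eLpNorm_mono_measure _
    (Measure.restrict_mono (parabolicCylinder_mono hρ.le hρθ z) le_rfl)

/-! ### The ball-mean gauge on a parabolic ball `Q(z₀, R)` -/

section Gauge

variable {z₀ : ℝ × EuclideanSpace ℝ (Fin 3)} {R : ℝ}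
  {u : ℝ → EuclideanSpace ℝ (Fin 3) → EuclideanSpace ℝ (Fin 3)}
  {p : ℝ → EuclideanSpace ℝ (Fin 3) → ℝ}

/-- `Q(z₀, R) = ]t₀ − R², t₀[ × B(x₀, R)`. [folklore] -/
private theorem parabolicCylinder_eq_prod (R : ℝ) (z₀ : ℝ × EuclideanSpace ℝ (Fin 3)) :
    parabolicCylinder R z₀ = Ioo (z₀.1 - R ^ 2) z₀.1 ×ˢ ball z₀.2 R := rfl

/-- Lebesgue measure restricted to a parabolic ball is finite. [folklore] -/
private theorem isFiniteMeasure_restrict_parabolicCylinder (R : ℝ)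
    (z₀ : ℝ × EuclideanSpace ℝ (Fin 3)) :
    IsFiniteMeasure (volume.restrict (parabolicCylinder R z₀)) :=
  ⟨by
    rw [Measure.restrict_apply_univ]
    exact lt_of_le_of_lt (measure_mono (parabolicCylinder_subset_Icc_prod_closedBall z₀ R))
      (isCompact_Icc_prod_closedBall z₀ R).measure_lt_top⟩

/-- Measurability of the time-dependent ball mean `(t, x) ↦ [p]_{B(x₀,R)}(t)` on `Q(z₀, R)` for
`p` measurable on `Q(z₀, R)`. [folklore] -/
private theorem aestronglyMeasurable_ballMean
    (hpm : AEStronglyMeasurable (uncurry p) (volume.restrict (parabolicCylinder R z₀))) :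
    AEStronglyMeasurable (fun w : ℝ × EuclideanSpace ℝ (Fin 3) => ⨍ y in ball z₀.2 R, p w.1 y)
      (volume.restrict (parabolicCylinder R z₀)) := by
  rw [parabolicCylinder_eq_prod] at hpm ⊢
  have hpB : AEStronglyMeasurable (uncurry p)
      ((volume.restrict (Ioo (z₀.1 - R ^ 2) z₀.1)).prod (volume.restrict (ball z₀.2 R))) := by
    rw [← volume_restrict_prod_eq]
    exact hpm
  have h := hpB.integral_prod_right'
  simp only [uncurry_apply_pair] at h
  simp_rw [setAverage_eq]
  rw [volume_restrict_prod_eq]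
  exact (h.const_smul ((volume : Measure (EuclideanSpace ℝ (Fin 3))).real (ball z₀.2 R))⁻¹)
    |>.comp_quasiMeasurePreserving Measure.quasiMeasurePreserving_fst

/-- **Jensen on the slices**: `∫_{Q(z₀,R)} |[p]_{B(x₀,R)}|^{3/2} ≤ ∫_{Q(z₀,R)} |p|^{3/2}`
(`lintegral_enorm_setAverage_slice_rpow_le_of_subset` with `B = S = B(x₀, R)`). [folklore] -/
private theorem lintegral_ballMean_le (hR : 0 < R)
    (hpm : AEStronglyMeasurable (uncurry p) (volume.restrict (parabolicCylinder R z₀))) :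
    ∫⁻ w in parabolicCylinder R z₀, ‖⨍ y in ball z₀.2 R, p w.1 y‖ₑ ^ (3 / 2 : ℝ) ≤
      ∫⁻ w in parabolicCylinder R z₀, ‖p w.1 w.2‖ₑ ^ (3 / 2 : ℝ) := by
  rw [parabolicCylinder_eq_prod] at hpm ⊢
  refine (lintegral_enorm_setAverage_slice_rpow_le_of_subset measure_ball_lt_top.ne
    Subset.rfl (by norm_num) hpm).trans ?_
  rw [ENNReal.mul_inv_cancel (measure_ball_pos volume z₀.2 hR).ne' measure_ball_lt_top.ne,
    one_mul]

/-- `L^{3/2}` class of the ball mean on `Q(z₀, R)`. [folklore] -/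
private theorem memLp_ballMean (hR : 0 < R)
    (hp : MemLp (uncurry p) (3 / 2) (volume.restrict (parabolicCylinder R z₀))) :
    MemLp (fun w : ℝ × EuclideanSpace ℝ (Fin 3) => ⨍ y in ball z₀.2 R, p w.1 y) (3 / 2)
      (volume.restrict (parabolicCylinder R z₀)) := by
  obtain ⟨h32, h32', h32r⟩ := threeHalves_facts
  refine ⟨aestronglyMeasurable_ballMean hp.1, ?_⟩
  rw [eLpNorm_eq_lintegral_rpow_enorm_toReal (zero_lt_one.trans_le h32).ne' h32', h32r]
  refine ENNReal.rpow_lt_top_of_nonneg (by positivity)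
    (lt_of_le_of_lt (lintegral_ballMean_le hR hp.1) ?_).ne
  have h := hp.2
  rw [eLpNorm_eq_lintegral_rpow_enorm_toReal (zero_lt_one.trans_le h32).ne' h32', h32r] at h
  have h' := ENNReal.rpow_lt_top_of_nonneg (show (0 : ℝ) ≤ 3 / 2 by norm_num) h.ne
  rw [← ENNReal.rpow_mul, show (1 / (3 / 2 : ℝ)) * (3 / 2) = 1 by norm_num, ENNReal.rpow_one] at h'
  exact h'

/-- **The ball-mean gauge keeps Albritton–Barker's class on the parabolic ball** (Seregin 2019
§1: the pressure of Def. 1.1 is determined up to a function of time and `D₀` is formed with the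
mean-free pressure; Caffarelli–Kohn–Nirenberg 1982, §2). If `(u, p)` is a suitable weak solution in
`Q(z₀, R)` in the sense of `IsSuitableWeakSolutionInBall` (`R > 0`), so is
`(u, p − [p]_{B(x₀,R)}(t))`: the local notion by `IsSuitableWeakSolutionOn.sub_pressure` (the
mean is `L^{3/2}(Q(z₀,R))` by Jensen, from the global pressure class of the parabolic ball), the
energy and gradient classes untouched, the pressure class by `memLp_ballMean`.
[cite: Seregin2019, Def. 1.1 and the quantity D₀ (arXiv:1906.06707 §1 p. 3)] -/
theorem isSuitableWeakSolutionInBall_sub_ballMean (hR : 0 < R)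
    (h : IsSuitableWeakSolutionInBall R z₀ u p) :
    IsSuitableWeakSolutionInBall R z₀ u (fun t x => p t x - ⨍ y in ball z₀.2 R, p t y) := by
  obtain ⟨hsw, hen, hgr, hq⟩ := h
  obtain ⟨h32, h32', h32r⟩ := threeHalves_facts
  haveI := isFiniteMeasure_restrict_parabolicCylinder R z₀
  have hm := memLp_ballMean hR hq
  have hint : IntegrableOn
      (fun w : ℝ × EuclideanSpace ℝ (Fin 3) => ⨍ y in ball z₀.2 R, p w.1 y)
      (parabolicCylinder R z₀) volume :=
    (hm.mono_exponent h32).integrable le_rfl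
  refine ⟨hsw.sub_pressure ?_ fun K hK hKc => ?_, hen, hgr, ?_⟩
  · rw [coe_parabolicCylinderOpens]
    exact hint.locallyIntegrableOn
  · rw [coe_parabolicCylinderOpens] at hK
    have h1 : ∫⁻ z in K, ‖⨍ y in ball z₀.2 R, p z.1 y‖ₑ ^ (3 / 2 : ℝ) ≤
        ∫⁻ z in parabolicCylinder R z₀, ‖⨍ y in ball z₀.2 R, p z.1 y‖ₑ ^ (3 / 2 : ℝ) :=
      lintegral_mono_set hK
    refine lt_of_le_of_lt h1 ?_
    have h2 := hm.2
    rw [eLpNorm_eq_lintegral_rpow_enorm_toReal (zero_lt_one.trans_le h32).ne' h32', h32r] at h2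
    have h3 := ENNReal.rpow_lt_top_of_nonneg (show (0 : ℝ) ≤ 3 / 2 by norm_num) h2.ne
    rw [← ENNReal.rpow_mul, show (1 / (3 / 2 : ℝ)) * (3 / 2) = 1 by norm_num, ENNReal.rpow_one] at h3
    exact h3
  · have e : uncurry (fun t x => p t x - ⨍ y in ball z₀.2 R, p t y) =
        uncurry p - fun w : ℝ × EuclideanSpace ℝ (Fin 3) => ⨍ y in ball z₀.2 R, p w.1 y := rfl
    rw [e]
    exact hq.sub hm

/-- **The background energies of a parabolic ball are finite**: for `(u, p)` in Albritton–Barker's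
class on `Q(z₀, R)`, `R > 0`, and any weak spatial gradient `G` of `u` there, `A(R; z₀) < ∞` (global
energy class) and `E(R; z₀) < ∞` (global class of SOME weak gradient and a.e. uniqueness of weak
gradients). The unit-radius case is the tree's `background_finite` (Albritton–Barker 2019, remark
after Lemma 2.6: the estimates depend on the finite "background quantities" of Def. 2.1).
[cite: AlbrittonBarker2019, Def. 2.1 and remark after Lemma 2.6] -/
theorem cknAEss_ne_top_and_cknE_ne_top_of_inBall (hR : 0 < R)
    (h : IsSuitableWeakSolutionInBall R z₀ u p)
    {G : ℝ → EuclideanSpace ℝ (Fin 3) → EuclideanSpace ℝ (Fin 3) →L[ℝ] EuclideanSpace ℝ (Fin 3)}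
    (hG : HasWeakSpatialGradientOn (parabolicCylinderOpens R z₀) u G) :
    cknAEss R z₀ u ≠ ∞ ∧ cknE R z₀ G ≠ ∞ := by
  obtain ⟨-, ⟨CA, hCA⟩, ⟨G', hG', hG'int⟩, -⟩ := h
  have hRpos : (ENNReal.ofReal R)⁻¹ ≠ ∞ :=
    ENNReal.inv_ne_top.2 (ENNReal.ofReal_pos.2 hR).ne'
  refine ⟨?_, ?_⟩
  · have hbound : ∀ᵐ t ∂(volume.restrict (Ioo (z₀.1 - R ^ 2) z₀.1)),
        (ENNReal.ofReal R)⁻¹ * ∫⁻ x in ball z₀.2 R, ‖u t x‖ₑ ^ 2 ≤ (ENNReal.ofReal R)⁻¹ * CA := by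
      filter_upwards [hCA] with t ht
      exact mul_le_mul' le_rfl ht
    refine ne_top_of_le_ne_top (ENNReal.mul_ne_top hRpos (ENNReal.coe_ne_top (r := CA))) ?_
    exact essSup_le_of_ae_le _ hbound
  · have hae := hG.ae_eq hG'
    rw [coe_parabolicCylinderOpens] at hae
    have heq : ∫⁻ w in parabolicCylinder R z₀, ENNReal.ofReal (frobeniusNormSq (G w.1 w.2)) =
        ∫⁻ w in parabolicCylinder R z₀, ENNReal.ofReal (frobeniusNormSq (G' w.1 w.2)) := by
      refine lintegral_congr_ae ?_
      filter_upwards [hae] with w hw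
      have hw' : G w.1 w.2 = G' w.1 w.2 := hw
      rw [hw']
    rw [cknE, heq]
    exact ENNReal.mul_ne_top hRpos hG'int.ne

end Gauge

/-! ### The `D₀`-form in the class of Seregin 2019, Def. 1.1 (`IsSuitableWeakSolutionInBall`) -/

/-- **Plumbing for the `D₀`-forms**: a universal `κ_P` such that, in Albritton–Barker's class on
`Q(z₀, R)` with `C ≤ M₁` on all sub-balls and `D₀(R; z₀) ≤ L`, the ball-mean–gauged pressure `q`
(same velocity) is a suitable weak solution on the open cylinder with a weak gradient `G`,
`A(R/2), E(R/2) < ∞`, and PLAIN `D(s; z₀)[q] ≤ κ_P (M₁ + L)` for all `0 < s ≤ R/2`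
(gauge `isSuitableWeakSolutionInBall_sub_ballMean`, identity `cknD_sub_ballMean`, iterated decay
estimate `exists_cknD_le_of_cknC_le`). [folklore] -/
private theorem inBall_plainD_package :
    ∃ κP : ℝ≥0, ∀ (M₁ L : ℝ≥0) (z₀ : ℝ × EuclideanSpace ℝ (Fin 3)) (R : ℝ)
      (u : ℝ → EuclideanSpace ℝ (Fin 3) → EuclideanSpace ℝ (Fin 3))
      (p : ℝ → EuclideanSpace ℝ (Fin 3) → ℝ), 0 < R →
      IsSuitableWeakSolutionInBall R z₀ u p →
      (∀ (z : ℝ × EuclideanSpace ℝ (Fin 3)) (r : ℝ), 0 < r →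
        parabolicCylinder r z ⊆ parabolicCylinder R z₀ → cknC r z u ≤ M₁) →
      cknDOsc R z₀ p ≤ L →
      ∃ (q : ℝ → EuclideanSpace ℝ (Fin 3) → ℝ)
        (G : ℝ → EuclideanSpace ℝ (Fin 3) → EuclideanSpace ℝ (Fin 3) →L[ℝ] EuclideanSpace ℝ (Fin 3)),
        IsSuitableWeakSolutionOn (parabolicCylinderOpens R z₀) 1 0 u q ∧
        HasWeakSpatialGradientOn (parabolicCylinderOpens R z₀) u G ∧
        parabolicCylinder (R / 2) z₀ ⊆
          ((parabolicCylinderOpens R z₀ : Opens (ℝ × EuclideanSpace ℝ (Fin 3))) :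
            Set (ℝ × EuclideanSpace ℝ (Fin 3))) ∧
        cknAEss (R / 2) z₀ u ≠ ∞ ∧ cknE (R / 2) z₀ G ≠ ∞ ∧
        ∀ s ∈ Ioc (0 : ℝ) (R / 2), cknD s z₀ q ≤ ((κP * (M₁ + L) : ℝ≥0) : ℝ≥0∞) := by
  obtain ⟨κP, HP⟩ := exists_cknD_le_of_cknC_le
  refine ⟨κP, fun M₁ L z₀ R u p hR hsw hC hD => ?_⟩
  -- the gauged pressure
  set q : ℝ → EuclideanSpace ℝ (Fin 3) → ℝ := fun t x => p t x - ⨍ y in ball z₀.2 R, p t y with hq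
  have hsw' : IsSuitableWeakSolutionInBall R z₀ u q := isSuitableWeakSolutionInBall_sub_ballMean hR hsw
  obtain ⟨hswOn, -, ⟨G, hG, -⟩, -⟩ := hsw'
  have hQ : parabolicCylinder R z₀ ⊆
      ((parabolicCylinderOpens R z₀ : Opens (ℝ × EuclideanSpace ℝ (Fin 3))) :
        Set (ℝ × EuclideanSpace ℝ (Fin 3))) := by
    rw [coe_parabolicCylinderOpens]
  -- plain `D` of the gauged pressure at all scales `≤ R/2`
  have hDR : cknD R z₀ q ≤ (L : ℝ≥0∞) := by
    rw [hq, cknD_sub_ballMean]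
    exact hD
  have hhalf : parabolicCylinder (R / 2) z₀ ⊆ parabolicCylinder R z₀ :=
    parabolicCylinder_mono (by positivity) (by linarith) z₀
  have hDall : ∀ s ∈ Ioc (0 : ℝ) (R / 2), cknD s z₀ q ≤ ((κP * (M₁ + L) : ℝ≥0) : ℝ≥0∞) := by
    intro s hs
    have h := HP (parabolicCylinderOpens R z₀) u q hswOn.distributional z₀ R hR hQ M₁ L
      (fun z r hr hsub => hC z r hr hsub) hDR z₀ hhalf s hs
    push_cast
    exact h
  -- finiteness of `A(R/2)`, `E(R/2)`
  obtain ⟨hA, hE⟩ := cknAEss_ne_top_and_cknE_ne_top_of_inBall hR hsw hG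
  have hR2 : 0 < R / 2 := half_pos hR
  have hA2 : cknAEss (R / 2) z₀ u ≠ ∞ := by
    refine ne_top_of_le_ne_top (ENNReal.mul_ne_top ENNReal.ofReal_ne_top hA)
      (cknAEss_le_mul_of_subset hR hR2 ?_ (ball_subset_ball (by linarith)) u)
    intro t ht
    exact ⟨by nlinarith [ht.1], ht.2⟩
  have hE2 : cknE (R / 2) z₀ G ≠ ∞ :=
    ne_top_of_le_ne_top (ENNReal.mul_ne_top ENNReal.ofReal_ne_top hE)
      (cknE_le_mul_of_subset hR hR2 hhalf G)
  exact ⟨q, G, hswOn, hG, hhalf.trans hQ, hA2, hE2, hDall⟩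

/-- **Seregin 2019, Prop. 4.1 with the mean-free pressure quantity `D₀`, contrapositive form
(4.4), in the class `IsSuitableWeakSolutionInBall R z₀ u p` of Def. 1.1.** For all `M₁, L ≥ 0`
there are `κ > 0` and `θ ∈ (0, 1]` such that: if `(u, p)` is a suitable weak solution in
`Q(z₀, R)`, `R > 0`, with `C(r; z) ≤ M₁` for every parabolic ball `Q_r(z) ⊆ Q(z₀, R)` (in print the
scale-invariant bound (4.5) `Θ ≤ c(M)(N+1)`) and `D₀(R; z₀) ≤ L` at the one scale `R`
(`D₀ = cknDOsc`), and `u` is NOT essentially bounded on `Q_ρ(z₀)` for some `ρ > 0`, then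
`κ ≤ C(r; z₀)` for every `r ∈ [ρ/θ, R/2]`. Proof: gauge the pressure by its `B(x₀,R)`-mean
(`isSuitableWeakSolutionInBall_sub_ballMean`; `D(R) = D₀(R)` by `cknD_sub_ballMean`), bound the
plain `D` of the gauged pressure at all scales `≤ R/2` by the iterated decay estimate
(`exists_cknD_le_of_cknC_le`), and apply `le_cknC_of_not_bounded` on `Q = Q(z₀, R)`.
[cite: Seregin2019, Prop. 4.1 and (4.4)–(4.5) (arXiv:1906.06707 §4)] -/
theorem le_cknC_of_not_bounded_inBall (M₁ L : ℝ≥0) :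
    ∃ κ θ : ℝ, 0 < κ ∧ 0 < θ ∧ θ ≤ 1 ∧
      ∀ (z₀ : ℝ × EuclideanSpace ℝ (Fin 3)) (R : ℝ)
        (u : ℝ → EuclideanSpace ℝ (Fin 3) → EuclideanSpace ℝ (Fin 3))
        (p : ℝ → EuclideanSpace ℝ (Fin 3) → ℝ), 0 < R →
        IsSuitableWeakSolutionInBall R z₀ u p →
        (∀ (z : ℝ × EuclideanSpace ℝ (Fin 3)) (r : ℝ), 0 < r →
          parabolicCylinder r z ⊆ parabolicCylinder R z₀ → cknC r z u ≤ M₁) →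
        cknDOsc R z₀ p ≤ L →
        ∀ ρ : ℝ, 0 < ρ →
          ¬ (eLpNorm (uncurry u) ∞ (volume.restrict (parabolicCylinder ρ z₀)) < ∞) →
          ∀ r ∈ Icc (ρ / θ) (R / 2), ENNReal.ofReal κ ≤ cknC r z₀ u := by
  obtain ⟨κP, HPk⟩ := inBall_plainD_package
  obtain ⟨κ, θ, hκ, hθ, hθ1, H⟩ := le_cknC_of_not_bounded (κP * (M₁ + L))
  refine ⟨κ, θ, hκ, hθ, hθ1, fun z₀ R u p hR hsw hC hD ρ hρ hunb r hr => ?_⟩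
  obtain ⟨q, G, hswOn, hG, hsub, hA2, hE2, hDall⟩ := HPk M₁ L z₀ R u p hR hsw hC hD
  exact H (parabolicCylinderOpens R z₀) u q G hswOn hG z₀ (R / 2) (half_pos hR) hsub hA2 hE2
    hDall ρ hρ hunb r hr

/-- **Seregin 2019, Prop. 4.1 with the mean-free pressure quantity `D₀`, direct form, in the
class `IsSuitableWeakSolutionInBall R z₀ u p`.** For all `M₁, L ≥ 0` there are `κ, θ, C⋆ > 0`
(`θ ≤ 1`) such that: if `(u, p)` is a suitable weak solution in `Q(z₀, R)`, `R > 0`, with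
`C(r; z) ≤ M₁` for every parabolic ball `Q_r(z) ⊆ Q(z₀, R)` and `D₀(R; z₀) ≤ L`, then for every
`0 < r ≤ R/2` with `C(r; z₀) ≤ κ`, `|u| ≤ C⋆ / r` a.e. on `Q_{θ r}(z₀)` (print: "`R⁻² ∫|v|³ < ε⋆(Z)`,
`D₀ < Z` ⇒ `sup_{Q(z₀,R/2)} |v| ≤ c⋆(Z)/R`", here at the inner scale `θ(Z)`).
[cite: Seregin2019, Prop. 4.1 (arXiv:1906.06707 §4)] -/
theorem ae_bound_of_cknC_le_inBall (M₁ L : ℝ≥0) :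
    ∃ κ θ Cst : ℝ, 0 < κ ∧ 0 < θ ∧ θ ≤ 1 ∧ 0 < Cst ∧
      ∀ (z₀ : ℝ × EuclideanSpace ℝ (Fin 3)) (R : ℝ)
        (u : ℝ → EuclideanSpace ℝ (Fin 3) → EuclideanSpace ℝ (Fin 3))
        (p : ℝ → EuclideanSpace ℝ (Fin 3) → ℝ), 0 < R →
        IsSuitableWeakSolutionInBall R z₀ u p →
        (∀ (z : ℝ × EuclideanSpace ℝ (Fin 3)) (r : ℝ), 0 < r →
          parabolicCylinder r z ⊆ parabolicCylinder R z₀ → cknC r z u ≤ M₁) →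
        cknDOsc R z₀ p ≤ L →
        ∀ r ∈ Ioc (0 : ℝ) (R / 2), cknC r z₀ u ≤ ENNReal.ofReal κ →
          ∀ᵐ w ∂(volume.restrict (parabolicCylinder (θ * r) z₀)), ‖u w.1 w.2‖ ≤ Cst / r := by
  obtain ⟨κP, HPk⟩ := inBall_plainD_package
  obtain ⟨κ, θ, Cst, hκ, hθ, hθ1, hCst, H⟩ := ae_bound_of_cknC_le (κP * (M₁ + L))
  refine ⟨κ, θ, Cst, hκ, hθ, hθ1, hCst, fun z₀ R u p hR hsw hC hD r hr hCle => ?_⟩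
  obtain ⟨q, G, hswOn, hG, hsub, hA2, hE2, hDall⟩ := HPk M₁ L z₀ R u p hR hsw hC hD
  exact H (parabolicCylinderOpens R z₀) u q G hswOn hG z₀ (R / 2) (half_pos hR) hsub hA2 hE2
    hDall r hr hCle

end Seregin2019

end Literature.Analysis.FluidPDE

end
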